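import Mathlib
import HarnessLib
import Summits.NavierStokesRegularity.NavierStokesRegularity.Theorems.TypeIQuarterGateScarEnvelopeTypeIForcedTsaiAlgCertF

/-!
# ARM B lane E-exact — a CERTIFIED POLYNOMIAL LEVEL FLOOR `floorCertT3K30` (τ = 3, degree 30)

`P(W) = Σ_k p_k W^k` designed (least-squares smooth step in the Chebyshev basis, then affine rescale) so that
`P ≤ 0` on `[0, W₁₀]` and `P ≤ 1` on `[W₁₀, 1]`, `W₁₀ = 9/109`, with the exact Taylor-shift certificate on
16 + 54 subintervals (`FloorCert.check`, replayed inside each row's `checkF`).  Captures ≈ 97–98 % of the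
`B₁₀` enstrophy of the Type-I-tail witnesses (vs ≈ 91–94 % for the structural floor of v1).  Producer:
`pub-ns-dss/wall-extremal/arm-B/alg/floor_design.py` + `floor_cert.py`.  Nothing about NS regularity.
-/

set_option linter.dupNamespace false

namespace Summit.NavierStokesRegularity.NavierStokesRegularity.Cruxes.ScarEnvelopeTypeI.ForcedTsai

/-- Certified polynomial floor of degree 30 for `τ = 3` (`W₁₀ = 9/109`). -/
def floorCertT3K30 : FloorCert where
  p := [(-3161565077 / 98130765000), (239900181242 / 12266345625),
    (-71178118848667 / 12266345625), (8342960917565288 / 12266345625),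
    (-103894822500021056 / 2453269125), (3973124420468896256 / 2453269125),
    (-101854922639421354752 / 2453269125), (619096356944278362112 / 817756375),
    (-5029738632316194095104 / 490653825), (261239771853878903701504 / 2453269125),
    (-92822433003851432329216 / 106663875), (13997914902246732284821504 / 2453269125),
    (-74775152187057717184036864 / 2453269125), (1646800668583603059369705472 / 12266345625),
    (-48293662783376713446326272 / 98130765), (6181926069060917904166354944 / 4088781875),
    (-47991746065646393545663184896 / 12266345625), (34984149985263740041876733952 / 4088781875),
    (-194282433070307110083937435648 / 12266345625), (60886209243161097539321593856 / 2453269125),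
    (-134366995998208251297076871168 / 4088781875), (149801505969793695866456899584 / 4088781875),
    (-139796539130739901191635861504 / 4088781875), (64957988716675722822836813824 / 2453269125),
    (-41235470107369385047481122816 / 2453269125), (21084440315792565238144958464 / 2453269125),
    (-8466591595811534339773038592 / 2453269125), (34265337232889884941746176 / 32710255),
    (-554115523498268809398059008 / 2453269125), (75608734261606076423077888 / 2453269125),
    (-4906646862092618268934144 / 2453269125)]
  cuts0 := [0, (9 / 6976), (9 / 3488),
    (9 / 1744), (27 / 3488), (9 / 872),
    (27 / 1744), (9 / 436), (45 / 1744),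
    (27 / 872), (9 / 218), (45 / 872),
    (27 / 436), (117 / 1744), (63 / 872),
    (135 / 1744), (9 / 109)]
  cuts1 := [(9 / 109), (97 / 872), (61 / 436),
    (269 / 1744), (563 / 3488), (147 / 872),
    (613 / 3488), (319 / 1744), (43 / 218),
    (369 / 1744), (197 / 872), (813 / 3488),
    (1651 / 6976), (3327 / 13952), (419 / 1744),
    (3377 / 13952), (1701 / 6976), (863 / 3488),
    (111 / 436), (469 / 1744), (247 / 872),
    (34 / 109), (569 / 1744), (297 / 872),
    (619 / 1744), (161 / 436), (347 / 872),
    (93 / 218), (397 / 872), (211 / 436),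
    (447 / 872), (59 / 109), (497 / 872),
    (261 / 436), (547 / 872), (143 / 218),
    (597 / 872), (311 / 436), (647 / 872),
    (84 / 109), (697 / 872), (361 / 436),
    (747 / 872), (193 / 218), (1569 / 1744),
    (797 / 872), (1619 / 1744), (411 / 436),
    (1669 / 1744), (847 / 872), (3413 / 3488),
    (1719 / 1744), (3463 / 3488), (6951 / 6976),
    1]

end Summit.NavierStokesRegularity.NavierStokesRegularity.Cruxes.ScarEnvelopeTypeI.ForcedTsai
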